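import Literature.MathematicalPhysics.QuantumFieldTheory.BalabanImbrieJaffe1984to88.BIJ88CrossTerm556

/-!
# `BalabanImbrieJaffe1984to88.BIJ88GaugeSummary5512` — T. Bałaban, J. Imbrie, A. Jaffe, *Effective action and cluster properties of
the abelian Higgs model*, Commun. Math. Phys. **114** (1988) 257–315 [BalabanImbrieJaffe1988], §5.5 *Second Gauge Field Translation*,
pp. 284–285: the approximation **(5.5.10)** `σ_{k,loc} ≈ Q^e_k(I − ∂𝒟_{k,loc}∂*)Q^{e*}_k` (typed as an identity with an EXPLICIT defect), the
display *"we may write the Λ₅^{(k)′**}f terms as ½⟨Λ₅^{(k)′**}f, σ^L_{k+1,loc}Λ₅^{(k)′**}f⟩ + ½⟨f, w₄f⟩"* (the `f`-quadratic third term of (5.5.3),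
PROVED by the computation of [2] §6.1, (6.1.3) → (6.1.9), in localized form, with `w₄` EXPLICIT), the form `𝒬₃`, and the SUMMARY **(5.5.12)**
of the two gauge-field translations — PROVED as inner-product ∕ operator algebra on the dictionary of `BIJ88CrossTerm556` (extended), knitting
(5.3.5), (5.5.3) `eq553`, the cross term `crossTerm_eq` ((5.5.6)–(5.5.9)), r16's (5.5.4) `eq554`, (5.5.7) `eq557` and (5.5.11)

statement-level skeleton of published theorems with citation tags; proofs where landed; nothing here is a claim about the Yang–Mills mass gap

PDF held: `paper:balaban1988-cmp114-bij-abelian-higgs-effective-action` (journal page = PDF page + 256).  Renders read this session as images: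
pp. 284–285 = PDF 28–29 (`pages/original-p028-x2.png`, `-p029-x2.png` in the p02 gen-5 seat folder); [2] = Bałaban–Imbrie–Jaffe, *Renormalization
of the Higgs model: minimizers, propagators and the stability of mean field theory*, CMP **97** (1985) [BalabanImbrieJaffe1985], §6.1 p. 319 =
PDF 21 of `paper:balaban1985-cmp97-bij-higgs-minimizers` (`pages85/original-p021-x2.png`, G4 decode of the scan, read as image).

**What the paper prints (p. 285, verbatim).**  *"Next we do a similar analysis on the third term in 𝒬′₁, the term quadratic in f. The important
contribution is when f is localized in Λ₅^{(k)′**}, in which case we obtain the quadratic form σ^L_{k+1,loc} for f, plus small errors. The analysis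
here parallels that of [2], Sect. 6.1, with adjustments for localized kernels. Using (5.5.4), (5.5.7), and
σ_{k,loc} ≈ Q^e_k(I − ∂𝒟_{k,loc}∂*)Q^{e*}_k, (5.5.10)   𝒟_{k,loc} + H_{k,loc}C^{(k)}_{loc}H*_{k,loc} = 𝒟^η_{k+1,loc}, (5.5.11)
we may write the Λ₅^{(k)′**}f terms as ½⟨Λ₅^{(k)′**}f, σ^L_{k+1,loc}Λ₅^{(k)′**}f⟩ + ½⟨f, w₄f⟩, with w₄ a small, short-ranged kernel. All terms involving
at least one Λ₅^{(k)′**c}f are assembled into a quadratic form 𝒬₃.  To summarize the effect of the two translations, we have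
½⟨Λ₅^{(k−1)′**}f^{(k)}, σ_{k,loc}Λ₅^{(k−1)′**}f^{(k)}⟩ = 𝒬₁ + 𝒬′₁ = 𝒬₁ + ½⟨Λ₁^{(k)**}∂A^{(k)}, σ_{k,loc}Λ₁^{(k)**}∂A^{(k)}⟩ + ½⟨Λ₅^{(k)′**}f, σ^L_{k+1,loc}Λ₅^{(k)′**}f⟩
+ 𝒬₂ + 𝒬₃ + ⟨f, w₃A^{(k)}⟩ + ½⟨f, w₄f⟩. (5.5.12)  Here 𝒬_i, i = 1, 2, 3, are large linear or quadratic forms, localized near Λ₅^{(k)c}. … The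
kernels w₃, w₄ are not localized near Λ₅^{(k)c}, but are small, have a range approximately r(e_k)"*.  [2] p. 319 prints the unlocalized
computation: (6.1.3) *"note that Q^eQ^e_k = Q^e_{k+1}"*, (6.1.5) `∂H_k = (I − ∂G_{k,Ax}∂*)Q^{e*}_k∂`, the translation (6.1.8) and *"(6.1.9)
⟨f^{(k)}, σ_kf^{(k)}⟩ = ⟨B, Δ_kB⟩ + L^{−d}⟨Q^{e*}_{k+1}f^{(k+1)}, (I − ∂G_{k,Ax}∂* − ∂H_kC^{(k)}H*_k∂*)Q^{e*}_{k+1}f^{(k+1)}⟩. Using (6.1.4) and the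
representation (5.1.15), we can rewrite (6.1.9) as … 𝒮_L^{−1}⟨f^{(k+1)}, σ_{k+1}f^{(k+1)}⟩, … σ_{k+1} = Q^e_{k+1}(I − ∂G_{k+1,Ax}∂*)Q^{e*}_{k+1}."*

**What is reproduced here (kernel-checked, zero `sorry`, no named facts).**  The carrier and dictionary `BIJ88CrossTerm556.Ops` (one real
inner-product space `M` of lattice fields, operators in `Module.End ℝ M`, rectangular typing suppressed as in the fold owner's files),
EXTENDED (`Ops`) by `Qesk` = Q^{e*}_k, `Qesk1`/`Qek1` = Q^{e*}_{k+1}/Q^e_{k+1}, `dηs` = ∂^{η*}, `Dloc` = 𝒟_{k,loc}, `Dk` = 𝒟_k, `Dnext` =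
𝒟^η_{k+1,loc}, `σL` = σ^L_{k+1,loc}, and the two regions of (5.3.5): `Λ5p` = Λ₅^{(k−1)′**}, `Λ2ss` = Λ₂^{(k)**}.  The printed-implicit facts are the
laws `Ops.Laws` (extending `BIJ88CrossTerm556.Ops.Laws`): the adjoint pairs `(Q^{e*}_k, Q^e_k)`, `(H*_{k,loc}, H_{k,loc})`, `(∂^{η*}, ∂^η)`; r16's
letter `X = ∂^{η*}Q^{e*}_{k+1}`; [2]'s *"Q^eQ^e_k = Q^e_{k+1}"* (and its adjoint); (5.5.11); and the support laws `Λ₂*Λ₄* = Λ₄*`,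
`Λ₁**Q^{e*}Λ₅′** = Q^{e*}Λ₅′**`, `Λ₅^{(k−1)′**}Λ₁** = Λ₁** = Λ₁**Λ₅^{(k−1)′**}`, `Λ₁**Λ₂** = Λ₂**` and the range statement of (5.3.5) (σ_{k,loc} does
not couple `Λ₂**` to `Λ₁**ᶜ`).
* **(5.3.5) on this carrier**: `Ops.fkTot` (f^{(k)} = Λ₁**ᶜg + Λ₁**(∂A′ + L⁻²Q^{e*}f), (5.3.2)), **`Ops.Q1`** (`𝒬₁`, printed body), `Ops.eq535_end`
  (`½⟨Λ₅′f^{(k)}, σΛ₅′f^{(k)}⟩ = 𝒬₁ + 𝒬′₁`; the matrix-carrier proof is `BIJ88Quad535.eq535`).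
* **(5.5.10)**: `Ops.w10` := σ_{k,loc} − Q^e_k(I − ∂𝒟_{k,loc}∂*)Q^{e*}_k (the defect the print's `≈` hides, DEFINED), `Ops.eq5510`/`eq5510_sigmaOp`
  (σ_{k,loc} = Q^e_k(I − ∂𝒟_{k,loc}∂*)Q^{e*}_k + w₁₀), `Ops.w10_eq_of_eq215` (by (2.15) `σ_k = Q^e_k(I − ∂𝒟_k∂*)Q^{e*}_k` the defect is the sum of the
  two localization errors `(σ_{k,loc} − σ_k) + Q^e_k∂(𝒟_{k,loc} − 𝒟_k)∂*Q^{e*}_k`), `Ops.w10_eq_zero`.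
* the third term of (5.5.3) `Ops.quadF f = ½⟨g_f, σ_{k,loc}g_f⟩` (`g_f` = `BIJ88CrossTerm556.Ops.gf`), its polar form `Ops.gForm`, **`Ops.Q3`**
  (the three bilinear pieces with a `Λ₅′**ᶜf`), `Ops.quadF_split` (`quadF f = quadF(Λ₅′**f) + 𝒬₃`).
* **`Ops.quadF_restr`** — the p. 285 display PROVED: `quadF(Λ₅′**f) = ½⟨Λ₅′**f, σ^L_{k+1,loc}Λ₅′**f⟩ + ½⟨f, w₄f⟩` with **`Ops.w4form`** EXPLICIT
  (`⟨f, w₄f⟩ = L⁻⁴⟨Q^{e*}f₅, w₁₀Q^{e*}f₅⟩ − 2L⁻⁴⟨w″₃C_{loc}Kf₅, Λ₁**Q^{e*}f₅⟩ + L⁻⁴⟨Kf₅, w‴₃C_{loc}Kf₅⟩ − ⟨f₅, w₁₀^Lf₅⟩`, `f₅ = Λ₅′**f`,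
  `K = H*_{k,loc}∂*Q^{e*}_{k+1}`, `w₁₀^L = σ^L_{k+1,loc} − L⁻⁴Q^e_{k+1}(I − ∂𝒟^η_{k+1,loc}∂*)Q^{e*}_{k+1}` = `Ops.w10L`, the (5.5.10)-defect at step k+1):
  mechanism = [2] (6.1.3)→(6.1.9): `⟨a, σa⟩` by (5.5.10), the cross term by (5.5.4) (`eq554`) and the adjoint pairs, `⟨b, σb⟩` by (5.5.7)
  (`eq557`), the main terms summing to `L⁻⁴⟨Q^{e*}_{k+1}f₅, (I − ∂(𝒟_{k,loc} + H_{k,loc}C^{(k)}_{loc}H*_{k,loc})∂*)Q^{e*}_{k+1}f₅⟩` = by (5.5.11)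
  `⟨f₅, σ̂f₅⟩`, `σ̂ = Ops.sigHat = L⁻⁴Q^e_{k+1}(I − ∂𝒟^η_{k+1,loc}∂*)Q^{e*}_{k+1}` ([2]'s `𝒮_L^{−1}σ_{k+1}`, localized); `Ops.w4form_eq_zero` (all four
  remainders absent ⇒ `w₄ = 0`: the exact computation of [2]).
* **`Ops.eq5512`** — (5.5.12) PROVED (with `eq5512_transl552` for r16's typed translation (5.5.2)); `Ops.Q3_eq_zero` (`Λ₅′** = I ⇒ 𝒬₃ = 0`);
  `Ops.h5511_of_curlyDloc` (the law (5.5.11) discharged by r16's `eq5511` when `𝒟_{k,loc}`, `𝒟^η_{k+1,loc}` are the sums (2.12)).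

**Readings (declared).**  (i) real Hilbert-space reading of `⟨·,·⟩`, lattice superscripts suppressed (as in `BIJ88Sect5StatementsPart3`);
(ii) `σ^L_{k+1,loc}` is a dictionary ENTRY (`Ops.σL`): the print does not define it on pp. 284–285 (superscript `L` = rescaling to the
L-lattice, p. 261); its (5.5.10)-type discrepancy from `σ̂` is the last constituent of `w₄` — with `σL := σ̂` that constituent is zero;
(iii) the support laws are hypotheses (nested regions with collars wider than the kernel ranges, (5.2.1)–(5.2.4)), not derived here.
**What is NOT claimed.**  The smallness ∕ range of `w₄` and of `w₁₀` ((5.5.5)-type bounds), the localization of `𝒬₃`, the decomposition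
`𝒬_i = Σ_μ 𝒬_i(X_μ)`, (5.5.13)–(5.5.14); nothing of B1–B16; NOT summit progress; NOT continuum; NOT Clay.  Imports `BIJ88CrossTerm556` only; no
Summits import; sub-namespace `…BIJ88GaugeSummary5512`; modifies nothing.  Cell `lit-balaban` Phase 2 (HOME `run/shared/lean/pub/lit-balaban/`),
seat p02 gen 5 (`literature-prover-lit-balaban-p02-g5-0`); row **C2.Eq5.5.1-5.5.12** (owner r16, referee ref-5), members (5.5.10), (5.5.12) and the
p. 285 display «absent» → typed ∕ proved.
-/

open scoped RealInnerProductSpace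
namespace Literature.MathematicalPhysics.QuantumFieldTheory.BalabanImbrieJaffe1984to88.BIJ88GaugeSummary5512
open BIJ88Sect5StatementsPart3 BIJ88Sect2Statements
noncomputable section

variable {M : Type*} [NormedAddCommGroup M] [InnerProductSpace ℝ M]

variable (M) in
/-- The dictionary of `BIJ88CrossTerm556.Ops` (σ_{k,loc}, σ_k, ∂, ∂*, Λ₁**, Λ₂*, □, Λ₄*, Λ₅′**, C^{(k)}_{loc}, H*_{k,loc}, X = ∂*Q^{e*}_{k+1},
K* = Q^e_{k+1}∂^ηH_{k,loc}, Q^{e*}, Q^e, Q^e_k, ∂^η, H_k, H_{k,loc}) extended by the letters of p. 285 and [2] §6.1: `Qesk` = Q^{e*}_k, `Qesk1` =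
Q^{e*}_{k+1}, `Qek1` = Q^e_{k+1}, `dηs` = ∂^{η*}, `Dloc` = 𝒟_{k,loc}, `Dk` = 𝒟_k, `Dnext` = 𝒟^η_{k+1,loc}, `σL` = σ^L_{k+1,loc}; and the regions of
(5.3.5): `Λ5p` = Λ₅^{(k−1)′**}, `Λ2ss` = Λ₂^{(k)**}. [cite: BalabanImbrieJaffe1988, (5.5.12) p.285] -/
structure Ops extends BIJ88CrossTerm556.Ops M where
  (Qesk Qesk1 Qek1 dηs Dloc Dk Dnext σL Λ5p Λ2ss : Module.End ℝ M)

namespace Ops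

variable (O : Ops M)

/-! ## §0  (5.3.2), (5.3.5) on this carrier: `f^{(k)}`, `𝒬₁`, `𝒬₁ + 𝒬′₁` -/

/-- **(5.3.2)** p. 280: `f^{(k)} = Λ₁^{(k)**c}g + Λ₁^{(k)**}(∂A′ + L⁻²Q^{e*}f)`, `g` the outside part `(ie_k)⁻¹ log u′(p)v(p′₀)` (abstract here).
[cite: BalabanImbrieJaffe1988, (5.3.2) p.280] -/
def fkTot (g A' f : M) : M := (g - O.Λ1 g) + O.Λ1 (O.fk A' f)

/-- **`𝒬₁`** of **(5.3.5)** p. 280: `𝒬₁ = ½⟨Λ₅^{(k−1)′**}Λ₁^{(k)**c}g + 2Λ₁^{(k)**}Λ₂^{(k)c**}h, σ_{k,loc}Λ₅^{(k−1)′**}Λ₁^{(k)**c}g⟩`, `h = ∂A′ + L⁻²Q^{e*}f`.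
[cite: BalabanImbrieJaffe1988, (5.3.5) p.280] -/
def Q1 (g h : M) : ℝ :=
  (1 / 2) * ⟪O.Λ5p (g - O.Λ1 g) + (2 : ℝ) • O.Λ1 (h - O.Λ2ss h), O.σloc (O.Λ5p (g - O.Λ1 g))⟫

/-! ## §1  (5.5.10): the approximation as an identity with an explicit defect -/

/-- **(5.5.10)** p. 285 [PDF 29], verbatim: *"σ_{k,loc} ≈ Q^e_k(I − ∂𝒟_{k,loc}∂*)Q^{e*}_k, (5.5.10)"* — the DEFECT hidden in `≈`, DEFINED:
`w₁₀ := σ_{k,loc} − Q^e_k(I − ∂^η𝒟_{k,loc}∂^{η*})Q^{e*}_k`. [cite: BalabanImbrieJaffe1988, (5.5.10) p.285] -/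
def w10 : Module.End ℝ M := O.σloc - O.Qe * (1 - O.dη * O.Dloc * O.dηs) * O.Qesk

/-- (5.5.10) as an identity: `σ_{k,loc} = Q^e_k(I − ∂𝒟_{k,loc}∂*)Q^{e*}_k + w₁₀`. [cite: BalabanImbrieJaffe1988, (5.5.10) p.285] -/
theorem eq5510 : O.σloc = O.Qe * (1 - O.dη * O.Dloc * O.dηs) * O.Qesk + O.w10 := by
  rw [w10]; abel

/-- (5.5.10) against the operator expression `sigmaOp` of (2.15). [cite: BalabanImbrieJaffe1988, (5.5.10) p.285] -/
theorem eq5510_sigmaOp : O.σloc = sigmaOp O.Qe O.Qesk O.dη O.dηs O.Dloc + O.w10 := by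
  rw [sigmaOp]; exact O.eq5510

/-- (5.5.10) pointwise. [cite: BalabanImbrieJaffe1988, (5.5.10) p.285] -/
theorem eq5510_apply (x : M) :
    O.σloc x = O.Qe (O.Qesk x - O.dη (O.Dloc (O.dηs (O.Qesk x)))) + O.w10 x := by
  simp only [w10, LinearMap.sub_apply, Module.End.mul_apply, Module.End.one_apply, map_sub]
  abel

/-- Why `w₁₀` is a localization error: with **(2.15)** `σ_k = Q^e_k(I − ∂𝒟_k∂*)Q^{e*}_k` (`BIJ88Sect2Statements.sigmaOp`),
`w₁₀ = (σ_{k,loc} − σ_k) + Q^e_k∂(𝒟_{k,loc} − 𝒟_k)∂*Q^{e*}_k` — the truncation error of (2.14) plus the one of (2.12)/(5.4.3).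
[cite: BalabanImbrieJaffe1988, (5.5.10) p.285] -/
theorem w10_eq_of_eq215 (hσ : O.σ = sigmaOp O.Qe O.Qesk O.dη O.dηs O.Dk) :
    O.w10 = (O.σloc - O.σ) + O.Qe * O.dη * (O.Dloc - O.Dk) * O.dηs * O.Qesk := by
  rw [w10, hσ, sigmaOp]
  noncomm_ring

/-- exact case: if `σ_{k,loc}` IS `Q^e_k(I − ∂𝒟_{k,loc}∂*)Q^{e*}_k` then `w₁₀ = 0`. [cite: BalabanImbrieJaffe1988, (5.5.10) p.285] -/
theorem w10_eq_zero (h : O.σloc = sigmaOp O.Qe O.Qesk O.dη O.dηs O.Dloc) : O.w10 = 0 := by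
  rw [w10, h, sigmaOp]
  exact sub_self _

/-! ## §2  The third term of (5.5.3) (quadratic in `f`) and `𝒬₃` -/

/-- the printed slot of (5.5.3) with its `L⁻²` pulled out: `g_f = L⁻²(Λ₁**Q^{e*}f − ∂Λ₄*C_{loc}H*_{loc}∂*Q^{e*}_{k+1}f)`.
[cite: BalabanImbrieJaffe1988, (5.5.3) p.284] -/
theorem gf_eq (f : M) : O.gf f = O.L⁻¹ ^ 2 • (O.Λ1 (O.Qes f) - O.d (O.Λ4 (O.Cloc (O.Hsloc (O.X f))))) := by
  simp only [BIJ88CrossTerm556.Ops.gf, BIJ88CrossTerm556.Ops.S, LinearMap.smul_apply, Module.End.mul_apply, map_smul, smul_sub]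

/-- `g_f` is additive in `f`. [cite: BalabanImbrieJaffe1988, (5.5.3) p.284] -/
theorem gf_add (f₁ f₂ : M) : O.gf (f₁ + f₂) = O.gf f₁ + O.gf f₂ := by
  rw [O.gf_eq, O.gf_eq, O.gf_eq, ← smul_add]
  congr 1
  simp only [map_add]
  abel

/-- the polar (bilinear) form of the third term of (5.5.3): `½⟨g_{f₁}, σ_{k,loc}g_{f₂}⟩`. [cite: BalabanImbrieJaffe1988, (5.5.3) p.284] -/
def gForm (f₁ f₂ : M) : ℝ := (1 / 2) * ⟪O.gf f₁, O.σloc (O.gf f₂)⟫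

/-- the third term of **(5.5.3)**, *"the term quadratic in f"* (p. 284): `½L⁻⁴⟨Λ₁**Q^{e*}f − ∂Λ₄*C_{loc}H*_{loc}∂*Q^{e*}_{k+1}f, σ_{k,loc}(…)⟩ =
½⟨g_f, σ_{k,loc}g_f⟩` (the last summand of `BIJ88CrossTerm556.Ops.eq553`). [cite: BalabanImbrieJaffe1988, (5.5.3) p.284] -/
def quadF (f : M) : ℝ := (1 / 2) * ⟪O.gf f, O.σloc (O.gf f)⟫

/-- `quadF f = gForm f f`. [cite: BalabanImbrieJaffe1988, (5.5.3) p.284] -/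
theorem quadF_eq_gForm (f : M) : O.quadF f = O.gForm f f := rfl

/-- additivity of `gForm` in the first slot. [cite: BalabanImbrieJaffe1988, (5.5.3) p.284] -/
theorem gForm_add_left (f₁ f₂ f₃ : M) : O.gForm (f₁ + f₂) f₃ = O.gForm f₁ f₃ + O.gForm f₂ f₃ := by
  simp only [gForm, gf_add, inner_add_left]
  ring

/-- additivity of `gForm` in the second slot. [cite: BalabanImbrieJaffe1988, (5.5.3) p.284] -/
theorem gForm_add_right (f₁ f₂ f₃ : M) : O.gForm f₁ (f₂ + f₃) = O.gForm f₁ f₂ + O.gForm f₁ f₃ := by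
  simp only [gForm, gf_add, map_add, inner_add_right]
  ring

/-- **`𝒬₃`** (p. 285): *"All terms involving at least one Λ₅^{(k)′**c}f are assembled into a quadratic form 𝒬₃"* := the three bilinear pieces of
`quadF(Λ₅′**f + Λ₅′**ᶜf)` containing a `Λ₅′**ᶜf = f − Λ₅′**f`. [cite: BalabanImbrieJaffe1988, (5.5.12) p.285] -/
def Q3 (f : M) : ℝ :=
  O.gForm (O.Λ5 f) (f - O.Λ5 f) + O.gForm (f - O.Λ5 f) (O.Λ5 f) + O.gForm (f - O.Λ5 f) (f - O.Λ5 f)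

/-- `quadF f = quadF(Λ₅′**f) + 𝒬₃(f)` (bilinearity only). [cite: BalabanImbrieJaffe1988, (5.5.12) p.285] -/
theorem quadF_split (f : M) : O.quadF f = O.quadF (O.Λ5 f) + O.Q3 f := by
  have hf : O.Λ5 f + (f - O.Λ5 f) = f := by abel
  conv_lhs => rw [← hf]
  rw [quadF_eq_gForm, quadF_eq_gForm, gForm_add_left, gForm_add_right, gForm_add_right, Q3]
  ring

/-- `𝒬₃` vanishes when there is no localization `Λ₅^{(k)′**}` (`Λ₅′** = I`). [cite: BalabanImbrieJaffe1988, (5.5.12) p.285] -/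
theorem Q3_eq_zero (h5 : O.Λ5 = 1) (f : M) : O.Q3 f = 0 := by
  have h0 : O.gf 0 = 0 := by rw [O.gf_eq]; simp
  simp [Q3, gForm, h5, h0]

/-! ## §3  The `Λ₅^{(k)′**}f` terms: `σ^L_{k+1,loc}` and `w₄` ([2] §6.1 in localized form) -/

/-- `σ̂ := L⁻⁴Q^e_{k+1}(I − ∂^η𝒟^η_{k+1,loc}∂^{η*})Q^{e*}_{k+1}` — [2]'s `𝒮_L^{−1}σ_{k+1}` ((6.1.9) + (5.1.15)) with the localized propagator of
(5.5.11); the (5.5.10)-form at step `k+1` on the L-lattice. [cite: BalabanImbrieJaffe1988, (5.5.12) p.285] -/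
def sigHat : Module.End ℝ M := O.L⁻¹ ^ 4 • (O.Qek1 * (1 - O.dη * O.Dnext * O.dηs) * O.Qesk1)

/-- `σ̂` against the operator expression `sigmaOp` of (2.15) at step `k+1`. [cite: BalabanImbrieJaffe1988, (5.5.12) p.285] -/
theorem sigHat_eq_sigmaOp : O.sigHat = O.L⁻¹ ^ 4 • sigmaOp O.Qek1 O.Qesk1 O.dη O.dηs O.Dnext := by
  rw [sigHat, sigmaOp]

/-- the (5.5.10)-defect at step `k+1` (L-lattice): `w₁₀^L := σ^L_{k+1,loc} − σ̂`. [cite: BalabanImbrieJaffe1988, (5.5.10) p.285] -/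
def w10L : Module.End ℝ M := O.σL - O.sigHat

/-- **`⟨f, w₄f⟩`** (p. 285): *"+ ½⟨f, w₄f⟩, with w₄ a small, short-ranged kernel"* — EXPLICIT: with `f₅ = Λ₅′**f`, `K = H*_{k,loc}∂*Q^{e*}_{k+1}`,
`⟨f, w₄f⟩ = L⁻⁴(⟨Q^{e*}f₅, w₁₀Q^{e*}f₅⟩ − 2⟨w″₃C_{loc}Kf₅, Λ₁**Q^{e*}f₅⟩ + ⟨Kf₅, w‴₃C_{loc}Kf₅⟩) − ⟨f₅, w₁₀^Lf₅⟩` — the remainders of (5.5.10), (5.5.4),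
(5.5.7) and of (5.5.10) at step `k+1`. [cite: BalabanImbrieJaffe1988, (5.5.12) p.285] -/
def w4form (f : M) : ℝ :=
  O.L⁻¹ ^ 4 * (⟪O.Qes (O.Λ5 f), O.w10 (O.Qes (O.Λ5 f))⟫
      - 2 * ⟪O.w3'' (O.Cloc (O.Hsloc (O.X (O.Λ5 f)))), O.Λ1 (O.Qes (O.Λ5 f))⟫
      + ⟪O.Hsloc (O.X (O.Λ5 f)), O.w3''' (O.Cloc (O.Hsloc (O.X (O.Λ5 f))))⟫)
    - ⟪O.Λ5 f, O.w10L (O.Λ5 f)⟫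

/-- In the exact situation of [2] §6.1 (no defects: `w₁₀ = 0`, `w″₃ = 0`, `w‴₃ = 0`, `σ^L_{k+1,loc} = σ̂`) the kernel `w₄` is absent.
[cite: BalabanImbrieJaffe1988, (5.5.12) p.285] -/
theorem w4form_eq_zero (h10 : O.w10 = 0) (h3 : O.w3'' = 0) (h3' : O.w3''' = 0) (hL : O.w10L = 0) (f : M) :
    O.w4form f = 0 := by
  simp [w4form, h10, h3, h3', hL]

/-- The printed-implicit facts used on p. 285 on top of `BIJ88CrossTerm556.Ops.Laws`: the adjoint pairs `(Q^{e*}_k, Q^e_k)`, `(H*_{k,loc}, H_{k,loc})`,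
`(∂^{η*}, ∂^η)`; the letter `X = ∂^{η*}Q^{e*}_{k+1}`; [2] p. 319 *"Q^eQ^e_k = Q^e_{k+1}"* and its adjoint `Q^{e*}_kQ^{e*} = Q^{e*}_{k+1}`; **(5.5.11)**; the
support laws `Λ₂*Λ₄* = Λ₄*`, `Λ₁**Q^{e*}Λ₅′** = Q^{e*}Λ₅′**`; and for (5.3.5): `Λ₅^{(k−1)′**}Λ₁** = Λ₁** = Λ₁**Λ₅^{(k−1)′**}`, `Λ₁**Λ₂** = Λ₂**`, and the
range statement (σ_{k,loc} does not couple `Λ₂^{(k)**}` to `Λ₁^{(k)**c}`). [cite: BalabanImbrieJaffe1988, (5.5.12) p.285] -/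
structure Laws : Prop extends BIJ88CrossTerm556.Ops.Laws O.toOps where
  adjQk : ∀ x y : M, ⟪O.Qesk x, y⟫ = ⟪x, O.Qe y⟫
  adjH : ∀ x y : M, ⟪O.Hsloc x, y⟫ = ⟪x, O.Hloc y⟫
  adjDη : ∀ x y : M, ⟪O.dηs x, y⟫ = ⟪x, O.dη y⟫
  hX : O.X = O.dηs * O.Qesk1
  hQesk1 : O.Qesk * O.Qes = O.Qesk1
  hQek1 : O.Qe1 * O.Qe = O.Qek1
  h5511 : O.Dnext = O.Dloc + O.Hloc * O.Cloc * O.Hsloc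
  hΛ24 : O.Λ2 * O.Λ4 = O.Λ4
  hΛ1Q5 : O.Λ1 * O.Qes * O.Λ5 = O.Qes * O.Λ5
  hΛ5p1 : O.Λ5p * O.Λ1 = O.Λ1
  hΛ15p : O.Λ1 * O.Λ5p = O.Λ1
  hΛ12ss : O.Λ1 * O.Λ2ss = O.Λ2ss
  hrange535 : ∀ x y : M, ⟪O.Λ2ss x, O.σloc (y - O.Λ1 y)⟫ = 0

/-- The law (5.5.11) is r16's PROVED recursion `BIJ88Sect5StatementsPart3.eq5511` when `𝒟_{k,loc}`, `𝒟^η_{k+1,loc}` are the sums (2.12)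
`curlyDloc` of localized sequences whose `k`-th entries are the dictionary's `H_{k,loc}`, `C^{(k)}_{loc}`, `H*_{k,loc}`.
[cite: BalabanImbrieJaffe1988, (5.5.11) p.285] -/
theorem h5511_of_curlyDloc {Hl Cl Hsl : ℕ → Module.End ℝ M} {k : ℕ} (hD : O.Dloc = curlyDloc Hl Cl Hsl k)
    (hD' : O.Dnext = curlyDloc Hl Cl Hsl (k + 1)) (hH : Hl k = O.Hloc) (hC : Cl k = O.Cloc) (hHs : Hsl k = O.Hsloc) :
    O.Dnext = O.Dloc + O.Hloc * O.Cloc * O.Hsloc := by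
  rw [hD', hD, ← eq5511, hH, hC, hHs]

/-- the adjoint pair `(Q^{e*}_{k+1}, Q^e_{k+1})`, from `(Q^{e*}_k, Q^e_k)`, `(Q^{e*}, Q^e)` and [2]'s `Q^eQ^e_k = Q^e_{k+1}`.
[cite: BalabanImbrieJaffe1985, (6.1.3) p.319] -/
theorem adjQk1 (h : O.Laws) (x y : M) : ⟪O.Qesk1 x, y⟫ = ⟪x, O.Qek1 y⟫ := by
  have e1 : O.Qesk1 x = O.Qesk (O.Qes x) := by
    simpa only [Module.End.mul_apply] using (LinearMap.congr_fun h.hQesk1 x).symm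
  have e2 : O.Qek1 y = O.Qe1 (O.Qe y) := by
    simpa only [Module.End.mul_apply] using (LinearMap.congr_fun h.hQek1 y).symm
  rw [e1, e2, h.adjQk, h.adjQ]

/-- `⟨f₅, σ̂f₅⟩ = L⁻⁴(⟨Q^{e*}_{k+1}f₅, (I − ∂𝒟_{k,loc}∂*)Q^{e*}_{k+1}f₅⟩ − ⟨Q^{e*}_{k+1}f₅, ∂H_{k,loc}C^{(k)}_{loc}H*_{k,loc}∂*Q^{e*}_{k+1}f₅⟩)` — (5.5.11) read
inside `σ̂` ([2]: *"using … the representation (5.1.15), we can rewrite (6.1.9) as … σ_{k+1}"*). [cite: BalabanImbrieJaffe1988, (5.5.11) p.285] -/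
theorem inner_sigHat (h : O.Laws) (u : M) :
    ⟪u, O.sigHat u⟫ = O.L⁻¹ ^ 4 *
      (⟪O.Qesk1 u, O.Qesk1 u - O.dη (O.Dloc (O.dηs (O.Qesk1 u)))⟫
        - ⟪O.Qesk1 u, O.dη (O.Hloc (O.Cloc (O.Hsloc (O.dηs (O.Qesk1 u)))))⟫) := by
  have e5511 : O.Dnext (O.dηs (O.Qesk1 u)) =
      O.Dloc (O.dηs (O.Qesk1 u)) + O.Hloc (O.Cloc (O.Hsloc (O.dηs (O.Qesk1 u)))) := by
    simpa only [Module.End.mul_apply, LinearMap.add_apply] using LinearMap.congr_fun h.h5511 (O.dηs (O.Qesk1 u))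
  rw [sigHat, LinearMap.smul_apply, real_inner_smul_right]
  simp only [Module.End.mul_apply, LinearMap.sub_apply, Module.End.one_apply]
  rw [← O.adjQk1 h, e5511, map_add, ← inner_sub_right, sub_sub]

/-- **The p. 285 display, PROVED**: *"we may write the Λ₅^{(k)′**}f terms as ½⟨Λ₅^{(k)′**}f, σ^L_{k+1,loc}Λ₅^{(k)′**}f⟩ + ½⟨f, w₄f⟩"* — with the
explicit `⟨f, w₄f⟩ = w4form f`, by the computation of [2] §6.1 ((6.1.3) → (6.1.9)) in localized form: `⟨a, σa⟩` via (5.5.10), the cross term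
via (5.5.4) (r16's `eq554`), `⟨b, σb⟩` via (5.5.7) (r16's `eq557`), the main terms combining through (5.5.11) into `σ̂`.
[cite: BalabanImbrieJaffe1988, (5.5.12) p.285] -/
theorem quadF_restr (h : O.Laws) (f : M) :
    O.quadF (O.Λ5 f) = (1 / 2) * ⟪O.Λ5 f, O.σL (O.Λ5 f)⟫ + (1 / 2) * O.w4form f := by
  -- support facts at `f₅ = Λ₅′**f`
  have e45 : O.Λ4 (O.Cloc (O.Hsloc (O.X (O.Λ5 f)))) = O.Cloc (O.Hsloc (O.X (O.Λ5 f))) := by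
    simpa only [Module.End.mul_apply] using LinearMap.congr_fun h.hΛ45 f
  have e1Q : O.Λ1 (O.Qes (O.Λ5 f)) = O.Qes (O.Λ5 f) := by
    simpa only [Module.End.mul_apply] using LinearMap.congr_fun h.hΛ1Q5 f
  have e24 : O.Λ2 (O.Cloc (O.Hsloc (O.X (O.Λ5 f)))) = O.Cloc (O.Hsloc (O.X (O.Λ5 f))) := by
    have e := LinearMap.congr_fun h.hΛ24 (O.Cloc (O.Hsloc (O.X (O.Λ5 f))))
    simp only [Module.End.mul_apply] at e
    rwa [e45] at e
  have eX : O.X (O.Λ5 f) = O.dηs (O.Qesk1 (O.Λ5 f)) := by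
    simpa only [Module.End.mul_apply] using LinearMap.congr_fun h.hX (O.Λ5 f)
  have eQk : O.Qesk (O.Qes (O.Λ5 f)) = O.Qesk1 (O.Λ5 f) := by
    simpa only [Module.End.mul_apply] using LinearMap.congr_fun h.hQesk1 (O.Λ5 f)
  -- Term A, by (5.5.10): `⟨Λ₁Q^{e*}f₅, σΛ₁Q^{e*}f₅⟩ = ⟨Q^{e*}_{k+1}f₅, (I − ∂𝒟_{loc}∂*)Q^{e*}_{k+1}f₅⟩ + ⟨Q^{e*}f₅, w₁₀Q^{e*}f₅⟩`
  have tA : ⟪O.Λ1 (O.Qes (O.Λ5 f)), O.σloc (O.Λ1 (O.Qes (O.Λ5 f)))⟫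
      = ⟪O.Qesk1 (O.Λ5 f), O.Qesk1 (O.Λ5 f) - O.dη (O.Dloc (O.dηs (O.Qesk1 (O.Λ5 f))))⟫
        + ⟪O.Qes (O.Λ5 f), O.w10 (O.Qes (O.Λ5 f))⟫ := by
    rw [e1Q, O.eq5510_apply (O.Qes (O.Λ5 f)), inner_add_right, ← h.adjQk, eQk]
  -- Term B, by (5.5.4): `⟨∂C_{loc}Kf₅, σΛ₁Q^{e*}f₅⟩ = ⟨C_{loc}Kf₅, Kf₅⟩ + ⟨w″₃C_{loc}Kf₅, Λ₁Q^{e*}f₅⟩`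
  have e554 : O.σloc (O.d (O.Λ2 (O.Cloc (O.Hsloc (O.X (O.Λ5 f)))))) =
      O.Qe (O.dη (O.Hloc (O.Λ2 (O.Cloc (O.Hsloc (O.X (O.Λ5 f))))))) + O.w3'' (O.Cloc (O.Hsloc (O.X (O.Λ5 f)))) := by
    simpa only [Module.End.mul_apply, LinearMap.add_apply, BIJ88CrossTerm556.Ops.w3''] using
      LinearMap.congr_fun (eq554 h.h551 h.hrange O.Hloc).2.2 (O.Cloc (O.Hsloc (O.X (O.Λ5 f))))
  have eK : O.Kst (O.Cloc (O.Hsloc (O.X (O.Λ5 f)))) =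
      O.Qe1 (O.Qe (O.dη (O.Hloc (O.Cloc (O.Hsloc (O.X (O.Λ5 f))))))) := by
    simpa only [Module.End.mul_apply] using LinearMap.congr_fun h.hK (O.Cloc (O.Hsloc (O.X (O.Λ5 f))))
  have e1J : O.Λ1 (O.Qe (O.dη (O.Hloc (O.Λ2 (O.Cloc (O.Hsloc (O.X (O.Λ5 f)))))))) =
      O.Qe (O.dη (O.Hloc (O.Λ2 (O.Cloc (O.Hsloc (O.X (O.Λ5 f))))))) := by
    simpa only [Module.End.mul_apply] using LinearMap.congr_fun h.hΛ1J (O.Cloc (O.Hsloc (O.X (O.Λ5 f))))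
  have t1 : ⟪O.Qe (O.dη (O.Hloc (O.Λ2 (O.Cloc (O.Hsloc (O.X (O.Λ5 f))))))), O.Λ1 (O.Qes (O.Λ5 f))⟫
      = ⟪O.Cloc (O.Hsloc (O.X (O.Λ5 f))), O.Hsloc (O.X (O.Λ5 f))⟫ := by
    rw [← h.Λ1sym, e1J, e24, real_inner_comm, h.adjQ, ← eK, ← h.adjK, real_inner_comm]
  have tB : ⟪O.d (O.Λ4 (O.Cloc (O.Hsloc (O.X (O.Λ5 f))))), O.σloc (O.Λ1 (O.Qes (O.Λ5 f)))⟫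
      = ⟪O.Cloc (O.Hsloc (O.X (O.Λ5 f))), O.Hsloc (O.X (O.Λ5 f))⟫
        + ⟪O.w3'' (O.Cloc (O.Hsloc (O.X (O.Λ5 f)))), O.Λ1 (O.Qes (O.Λ5 f))⟫ := by
    rw [e45, ← h.σsym]
    conv_lhs => rw [← e24]
    rw [e554, inner_add_left, t1]
  -- Term C, by (5.5.7): `⟨∂C_{loc}Kf₅, σ∂C_{loc}Kf₅⟩ = ⟨Kf₅, C_{loc}Kf₅⟩ + ⟨Kf₅, w‴₃C_{loc}Kf₅⟩`
  have tC : ⟪O.d (O.Λ4 (O.Cloc (O.Hsloc (O.X (O.Λ5 f))))), O.σloc (O.d (O.Λ4 (O.Cloc (O.Hsloc (O.X (O.Λ5 f))))))⟫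
      = ⟪O.Hsloc (O.X (O.Λ5 f)), O.Cloc (O.Hsloc (O.X (O.Λ5 f)))⟫
        + ⟪O.Hsloc (O.X (O.Λ5 f)), O.w3''' (O.Cloc (O.Hsloc (O.X (O.Λ5 f))))⟫ := by
    rw [e45, h.adjD, h.Csym, O.eq557_apply, inner_add_right]
  -- symmetries and the passage `⟨Kf₅, C_{loc}Kf₅⟩ = ⟨Q^{e*}_{k+1}f₅, ∂H_{loc}C_{loc}H*_{loc}∂*Q^{e*}_{k+1}f₅⟩`
  have hab : ⟪O.Λ1 (O.Qes (O.Λ5 f)), O.σloc (O.d (O.Λ4 (O.Cloc (O.Hsloc (O.X (O.Λ5 f))))))⟫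
      = ⟪O.d (O.Λ4 (O.Cloc (O.Hsloc (O.X (O.Λ5 f))))), O.σloc (O.Λ1 (O.Qes (O.Λ5 f)))⟫ := by
    rw [← h.σsym, real_inner_comm]
  have hCK : ⟪O.Cloc (O.Hsloc (O.X (O.Λ5 f))), O.Hsloc (O.X (O.Λ5 f))⟫
      = ⟪O.Hsloc (O.X (O.Λ5 f)), O.Cloc (O.Hsloc (O.X (O.Λ5 f)))⟫ := h.Csym _ _
  have hKK : ⟪O.Hsloc (O.X (O.Λ5 f)), O.Cloc (O.Hsloc (O.X (O.Λ5 f)))⟫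
      = ⟪O.Qesk1 (O.Λ5 f), O.dη (O.Hloc (O.Cloc (O.Hsloc (O.dηs (O.Qesk1 (O.Λ5 f))))))⟫ := by
    rw [eX, h.adjH, h.adjDη]
  have hw : ⟪O.Λ5 f, O.w10L (O.Λ5 f)⟫ = ⟪O.Λ5 f, O.σL (O.Λ5 f)⟫ - ⟪O.Λ5 f, O.sigHat (O.Λ5 f)⟫ := by
    rw [w10L, LinearMap.sub_apply, inner_sub_right]
  -- expand `quadF(Λ₅′**f) = ½L⁻⁴⟨a − b, σ(a − b)⟩` and substitute
  rw [quadF, O.gf_eq, map_smul, real_inner_smul_left, real_inner_smul_right, map_sub, inner_sub_left, inner_sub_right,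
    inner_sub_right, hab, tA, tB, tC, hCK, hKK, w4form, hw, O.inner_sigHat h]
  ring

/-- the `Λ₅′**f` terms with `σ̂` in place of `σ^L_{k+1,loc}` (reading (ii): taking `σ^L_{k+1,loc} := σ̂` removes the last constituent of `w₄`).
[cite: BalabanImbrieJaffe1988, (5.5.12) p.285] -/
theorem quadF_restr_sigHat (h : O.Laws) (hσL : O.σL = O.sigHat) (f : M) :
    O.quadF (O.Λ5 f) = (1 / 2) * ⟪O.Λ5 f, O.sigHat (O.Λ5 f)⟫ + (1 / 2) * O.w4form f := by
  rw [O.quadF_restr h, hσL]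

/-! ## §4  (5.3.5) and the summary (5.5.12) -/

/-- **(5.3.5)** p. 280 on this carrier: `½⟨Λ₅^{(k−1)′**}f^{(k)}, σ_{k,loc}Λ₅^{(k−1)′**}f^{(k)}⟩ = 𝒬₁ + 𝒬′₁` for `f^{(k)} = Λ₁**ᶜg + Λ₁**(∂A′ + L⁻²Q^{e*}f)`
(polarization + the range statement; the kernel-matrix proof is `BIJ88Quad535.eq535`). [cite: BalabanImbrieJaffe1988, (5.3.5) p.280] -/
theorem eq535_end (h : O.Laws) (g A' f : M) :
    (1 / 2) * ⟪O.Λ5p (O.fkTot g A' f), O.σloc (O.Λ5p (O.fkTot g A' f))⟫ = O.Q1 g (O.fk A' f) + O.Q1' A' f := by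
  have e51 : O.Λ5p (O.Λ1 (O.fk A' f)) = O.Λ1 (O.fk A' f) := by
    simpa only [Module.End.mul_apply] using LinearMap.congr_fun h.hΛ5p1 (O.fk A' f)
  have hsplit : O.Λ5p (O.fkTot g A' f) = O.Λ5p (g - O.Λ1 g) + O.Λ1 (O.fk A' f) := by
    rw [fkTot, map_add, e51]
  have e12 : O.Λ1 (O.Λ2ss (O.fk A' f)) = O.Λ2ss (O.fk A' f) := by
    simpa only [Module.End.mul_apply] using LinearMap.congr_fun h.hΛ12ss (O.fk A' f)
  have eG : O.Λ5p (g - O.Λ1 g) = O.Λ5p g - O.Λ1 (O.Λ5p g) := by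
    have e := LinearMap.congr_fun h.hΛ15p g
    have e' := LinearMap.congr_fun h.hΛ5p1 g
    simp only [Module.End.mul_apply] at e e'
    rw [map_sub, e', e]
  have hzero : ⟪O.Λ1 (O.Λ2ss (O.fk A' f)), O.σloc (O.Λ5p (g - O.Λ1 g))⟫ = 0 := by
    rw [e12, eG]
    exact h.hrange535 _ _
  have hH : O.Λ1 (O.fk A' f) = O.Λ1 (O.Λ2ss (O.fk A' f)) + O.Λ1 (O.fk A' f - O.Λ2ss (O.fk A' f)) := by
    rw [← map_add, add_sub_cancel]
  have hcross : ⟪O.Λ1 (O.fk A' f), O.σloc (O.Λ5p (g - O.Λ1 g))⟫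
      = ⟪O.Λ1 (O.fk A' f - O.Λ2ss (O.fk A' f)), O.σloc (O.Λ5p (g - O.Λ1 g))⟫ := by
    rw [hH, inner_add_left, hzero, zero_add]
  have hsym : ⟪O.Λ5p (g - O.Λ1 g), O.σloc (O.Λ1 (O.fk A' f))⟫ = ⟪O.Λ1 (O.fk A' f), O.σloc (O.Λ5p (g - O.Λ1 g))⟫ := by
    rw [← h.σsym, real_inner_comm]
  rw [hsplit, Q1, BIJ88CrossTerm556.Ops.Q1']
  simp only [map_add, inner_add_left, inner_add_right, real_inner_smul_left]
  rw [hsym, hcross]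
  ring

/-- **(5.5.12)** p. 285 [PDF 29], verbatim: *"To summarize the effect of the two translations, we have ½⟨Λ₅^{(k−1)′**}f^{(k)}, σ_{k,loc}Λ₅^{(k−1)′**}f^{(k)}⟩
= 𝒬₁ + 𝒬′₁ = 𝒬₁ + ½⟨Λ₁^{(k)**}∂A^{(k)}, σ_{k,loc}Λ₁^{(k)**}∂A^{(k)}⟩ + ½⟨Λ₅^{(k)′**}f, σ^L_{k+1,loc}Λ₅^{(k)′**}f⟩ + 𝒬₂ + 𝒬₃ + ⟨f, w₃A^{(k)}⟩ + ½⟨f, w₄f⟩.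
(5.5.12)"* — PROVED for `f^{(k)} = Λ₁**ᶜg + Λ₁**(∂A′ + L⁻²Q^{e*}f)` (5.3.2) with `A′ = A^{(k)} − Sf` (5.5.2), under the laws `Ops.Laws`, with `𝒬₂`, `⟨f, w₃A⟩`
of `BIJ88CrossTerm556` and the explicit `𝒬₁`, `𝒬₃`, `⟨f, w₄f⟩` of this file. [cite: BalabanImbrieJaffe1988, (5.5.12) p.285] -/
theorem eq5512 (h : O.Laws) (g A f : M) :
    (1 / 2) * ⟪O.Λ5p (O.fkTot g (A - O.S f) f), O.σloc (O.Λ5p (O.fkTot g (A - O.S f) f))⟫ =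
      O.Q1 g (O.fk (A - O.S f) f)
        + (1 / 2) * ⟪O.Λ1 (O.d A), O.σloc (O.Λ1 (O.d A))⟫
        + (1 / 2) * ⟪O.Λ5 f, O.σL (O.Λ5 f)⟫
        + O.Q2 A f + O.Q3 f + O.w3form A f + (1 / 2) * O.w4form f := by
  rw [O.eq535_end h, O.eq553 h.σsym h.hΛ14, O.crossTerm_eq h.toLaws,
    show (1 / 2) * ⟪O.gf f, O.σloc (O.gf f)⟫ = O.quadF f from rfl, O.quadF_split, O.quadF_restr h]
  ring

/-- (5.5.12) for r16's typed translation `transl552` (5.5.2). [cite: BalabanImbrieJaffe1988, (5.5.12) p.285] -/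
theorem eq5512_transl552 (h : O.Laws) (g A f : M) :
    (1 / 2) * ⟪O.Λ5p (O.fkTot g (transl552 O.L O.Λ4 O.Cloc O.Hsloc O.X A f) f),
        O.σloc (O.Λ5p (O.fkTot g (transl552 O.L O.Λ4 O.Cloc O.Hsloc O.X A f) f))⟫ =
      O.Q1 g (O.fk (A - O.S f) f)
        + (1 / 2) * ⟪O.Λ1 (O.d A), O.σloc (O.Λ1 (O.d A))⟫
        + (1 / 2) * ⟪O.Λ5 f, O.σL (O.Λ5 f)⟫
        + O.Q2 A f + O.Q3 f + O.w3form A f + (1 / 2) * O.w4form f := by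
  rw [O.transl552_eq_sub, O.eq5512 h]

end Ops

/-! ## §5  (v1.1) The size of the (5.5.10)-defect; the tree's unlocalized computation

Cross-references (nothing restated): the UNLOCALIZED computation of [2] §6.1 that `Ops.quadF_restr` localizes — (6.1.5), (6.1.6),
(6.1.9) and (6.1.1) *"σ_k = σ_{k+1} + fluctuation form"* — is PROVED in the tree as `BIJ85Eq611Proof.eq615/eq616/eq619/eq611`
(row C1.Eq6.1.1, seat p30); the first constituent of `w₁₀` (`Ops.w10_eq_of_eq215`), the truncation error `σ_{k,loc} − σ_k` of (2.14),
is controlled by (2.18) (`BIJ88Close218Proof.close218`), the second by the closeness of `𝒟_{k,loc}` to `𝒟_k` ((2.13), (5.4.3)); the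
support laws of `Ops.Laws` (reading (iii)) are discharged in matrix form — finite-range kernels against p. 274's collars — in
`BIJ88SupportLaws274` (seat p02). -/

/-- The operator-norm SHAPE of the (5.5.10)-defect in the form `w₁₀ = (σ_{k,loc} − σ_k) + Q^e_k∂^η(𝒟_{k,loc} − 𝒟_k)∂^{η*}Q^{e*}_k`
(`Ops.w10_eq_of_eq215`), for bounded operators on a real normed space: ‖w₁₀‖ ≤ ‖σ_{k,loc} − σ_k‖ + ‖Q^e_k‖‖∂^η‖‖𝒟_{k,loc} − 𝒟_k‖‖∂^{η*}‖‖Q^{e*}_k‖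
— small when the two localizations are good in operator norm ((2.18), (2.13)/(5.4.3)); the print's range statement for `w₄` is not
claimed. [cite: BalabanImbrieJaffe1988, (5.5.10) p.285] -/
theorem opNorm_w10_shape_le {E : Type*} [NormedAddCommGroup E] [NormedSpace ℝ E]
    (σloc σ Qe dη Dloc Dk dηs Qesk : E →L[ℝ] E) :
    ‖(σloc - σ) + Qe * dη * (Dloc - Dk) * dηs * Qesk‖
      ≤ ‖σloc - σ‖ + ‖Qe‖ * ‖dη‖ * ‖Dloc - Dk‖ * ‖dηs‖ * ‖Qesk‖ := by
  refine (norm_add_le _ _).trans (add_le_add le_rfl ?_)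
  calc ‖Qe * dη * (Dloc - Dk) * dηs * Qesk‖
      ≤ ‖Qe * dη * (Dloc - Dk) * dηs‖ * ‖Qesk‖ := norm_mul_le _ _
    _ ≤ ‖Qe * dη * (Dloc - Dk)‖ * ‖dηs‖ * ‖Qesk‖ := by gcongr; exact norm_mul_le _ _
    _ ≤ ‖Qe * dη‖ * ‖Dloc - Dk‖ * ‖dηs‖ * ‖Qesk‖ := by gcongr; exact norm_mul_le _ _
    _ ≤ ‖Qe‖ * ‖dη‖ * ‖Dloc - Dk‖ * ‖dηs‖ * ‖Qesk‖ := by gcongr; exact norm_mul_le _ _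

/-- the same shape read through `Ops.w10_eq_of_eq215`: if the dictionary's operators are (the underlying linear maps of) bounded
operators, `‖w₁₀‖` is bounded by the two localization errors. [cite: BalabanImbrieJaffe1988, (5.5.10) p.285] -/
theorem opNorm_w10_le {E : Type*} [NormedAddCommGroup E] [InnerProductSpace ℝ E] (O : Ops E)
    (σloc σ Qe dη Dloc Dk dηs Qesk w : E →L[ℝ] E)
    (hσloc : O.σloc = σloc) (hσ : O.σ = σ) (hQe : O.Qe = Qe) (hdη : O.dη = dη) (hDloc : O.Dloc = Dloc) (hDk : O.Dk = Dk)
    (hdηs : O.dηs = dηs) (hQesk : O.Qesk = Qesk) (h215 : O.σ = sigmaOp O.Qe O.Qesk O.dη O.dηs O.Dk)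
    (hw : O.w10 = (w : Module.End ℝ E)) :
    ‖w‖ ≤ ‖σloc - σ‖ + ‖Qe‖ * ‖dη‖ * ‖Dloc - Dk‖ * ‖dηs‖ * ‖Qesk‖ := by
  have e : (w : Module.End ℝ E) = (((σloc - σ) + Qe * dη * (Dloc - Dk) * dηs * Qesk : E →L[ℝ] E) : Module.End ℝ E) := by
    rw [← hw, O.w10_eq_of_eq215 h215, hσloc, hσ, hQe, hdη, hDloc, hDk, hdηs, hQesk]
    simp only [ContinuousLinearMap.toLinearMap_add, ContinuousLinearMap.toLinearMap_sub, ContinuousLinearMap.toLinearMap_mul]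
  have e' : w = (σloc - σ) + Qe * dη * (Dloc - Dk) * dηs * Qesk := ContinuousLinearMap.coe_injective e
  rw [e']
  exact opNorm_w10_shape_le σloc σ Qe dη Dloc Dk dηs Qesk

end

end Literature.MathematicalPhysics.QuantumFieldTheory.BalabanImbrieJaffe1984to88.BIJ88GaugeSummary5512
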